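import Mathlib
import HarnessLib

/-!
# Enflo 2023, v2 (31): the change of `εθ` under a Main-Construction step, as an exact identity

Source under adjudication: Per H. Enflo, *On the invariant subspace problem in Hilbert spaces*, arXiv:2305.15442 (v1
2023, v2 2024), bib key `Enflo2023` — a CLAIMED proof of the invariant subspace problem for operators on a separable
Hilbert space.  This file is part of the kernel-tight typing of the manuscript by the b2b-enflo repair cell
(formaliser 2, Part B: (28)–(47), the limiting argument and the final deduction).  It records what FOLLOWS (proved
implications from the manuscript's displayed hypotheses) and, where a step does not follow, the typed inference
together with its refutation.  NOTHING here asserts that the manuscript's main theorem holds; no declaration concludes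
the invariant subspace problem for an arbitrary operator.  Value (BLOCK-2b): theorems / refutations of typed
inferences about a text — not progress on the problem.

v2 p.16, eq. (31) (LaTeX l.522): with `v = [ ]⁻¹x₀`, `εθ = ⟨v, x₀ − v⟩` and `ch v` the change of `v` in a MC step,
"we want `εθ` to decrease, which means `⟨ch v, x₀ − 2v⟩ < 0` in first order".  Here the statement is made EXACT:
the change of `εθ` is `⟨ch v, x₀ − v⟩ − ⟨v, ch v⟩ − ‖ch v‖²`, whose real part is `Re⟨ch v, x₀ − 2v⟩ − ‖ch v‖²`
(`εθ` itself is real in the paper's setting, `[ ]⁻¹` being positive).  So (31) is correct to first order and the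
neglected term is exactly `−‖ch v‖²` (which only helps the decrease).  (32) is a desideratum ("‖[ ]⁻¹x₀‖ does not
tend to 0 or 1"), not an inference; nothing to type.  Dictionary: paper `⟨u, w⟩` (linear in `u`) = Mathlib `⟪w, u⟫_ℂ`.
-/

open scoped InnerProductSpace
open RCLike

namespace Literature.Analysis.OperatorTheory.Enflo2023

variable {H : Type*} [NormedAddCommGroup H] [InnerProductSpace ℂ H]

/-- (31) made exact: `εθ(v + c) − εθ(v) = ⟨c, x₀ − v⟩ − ⟨v, c⟩ − ⟨c, c⟩` for `εθ(v) = ⟨v, x₀ − v⟩`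
(paper convention; in Mathlib's `⟪x₀ − v, v⟫`). [cite: Enflo2023, v2 (31), p.16] -/
theorem eq31_exact (x₀ v c : H) :
    ⟪x₀ - (v + c), v + c⟫_ℂ - ⟪x₀ - v, v⟫_ℂ = ⟪x₀ - v, c⟫_ℂ - ⟪c, v⟫_ℂ - ⟪c, c⟫_ℂ := by
  simp only [inner_sub_left, inner_add_left, inner_add_right]
  ring

/-- (31), real part: `Re (εθ(v + c) − εθ(v)) = Re⟨c, x₀ − 2v⟩ − ‖c‖²` — the paper's first-order expression
`⟨ch[ ]⁻¹x₀, x₀ − 2[ ]⁻¹x₀⟩` plus the exact second-order remainder `−‖ch[ ]⁻¹x₀‖²`. [cite: Enflo2023, v2 (31), p.16] -/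
theorem eq31_re (x₀ v c : H) :
    re (⟪x₀ - (v + c), v + c⟫_ℂ - ⟪x₀ - v, v⟫_ℂ) = re ⟪x₀ - (2 : ℂ) • v, c⟫_ℂ - ‖c‖ ^ 2 := by
  rw [eq31_exact]
  have h1 : re ⟪c, v⟫_ℂ = re ⟪v, c⟫_ℂ := by
    rw [← inner_conj_symm, conj_re]
  have h2 : (re ⟪c, c⟫_ℂ : ℝ) = ‖c‖ ^ 2 := by
    rw [inner_self_eq_norm_sq_to_K]; norm_cast
  simp only [map_sub, inner_sub_left, inner_smul_left, map_ofNat, RCLike.ofNat_mul_re, h1, h2]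
  ring

end Literature.Analysis.OperatorTheory.Enflo2023
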